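import Summits.HodgeConjecture.HodgeCM.Model.ArchLineSlotType_1

/-! PORT of `HodgeCM/Model/ArchLineSlotType.lean` (HodgeCMPerL run 82) — part 2: continuation of `Summits.HodgeConjecture.HodgeCM.Model.ArchLineSlotType_1` (split at a top-level declaration boundary by port_pkg.py; scope re-opened below; declarations unchanged). -/

-- port_pkg: scope re-opened for this part (file-level context, then the namespace/section stack open at the cut)
set_option autoImplicit false
noncomputable section
open scoped Matrix Classical
open Literature.NumberTheory.Automorphic Literature.NumberTheory.Weil1964
open Literature.NumberTheory.GelbartRogawski1991.UnitaryDualPair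
open HodgeCM.Adelic HodgeCM.PerL34
namespace HodgeCM.Model.ArchSideTerm
section StageB
variable
  (χV χW : ∀ {L : CMField} {ι₁ : L →+* ℂ} (_V : HermSpace3 L ι₁) (_c : SeesawCtx L),
    ContinuousMonoidHom (relNormOneIdeles (↥(NumberField.maximalRealSubfield (L : Type))) (L : Type) ⧸
      relNormOneRat (↥(NumberField.maximalRealSubfield (L : Type))) (L : Type)) Circle)
variable {L : CMField} {ι₁ : L →+* ℂ} (V : HermSpace3 L ι₁) (c : SeesawCtx L)
variable
  (hGR : (cmSplittingDatum (L : Type) finProdFinEquiv (frameD V) (frameD_real V) (frameD_ne V) (dW c.D) (dW_real c.D) (dW_ne c.D)).CompatibleSplitting)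
  (hGR₀ : (cmSplittingDatum (L : Type) (e₁) (frameD V) (frameD_real V) (frameD_ne V) (lineVec (L : Type) (dW c.D 0))
    (fun _ => dW_real c.D 0) (fun _ => dW_ne c.D 0)).CompatibleSplitting)
  (hGR₁ : (cmSplittingDatum (L : Type) (e₁) (frameD V) (frameD_real V) (frameD_ne V) (lineVec (L : Type) (dW c.D 1))
    (fun _ => dW_real c.D 1) (fun _ => dW_ne c.D 1)).CompatibleSplitting)
  (hGR₂ : (cmSplittingDatum (L : Type) (e₁) (frameD V) (frameD_real V) (frameD_ne V) (lineVec (L : Type) (dW' c.D 0))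
    (fun _ => dW'_real c.D 0) (fun _ => dW'_ne c.D 0)).CompatibleSplitting)
  (hGR₃ : (cmSplittingDatum (L : Type) (e₁) (frameD V) (frameD_real V) (frameD_ne V) (lineVec (L : Type) (dW' c.D 1))
    (fun _ => dW'_real c.D 1) (fun _ => dW'_ne c.D 1)).CompatibleSplitting)
/-- **`hμ₂` at the Stage-B η ↔ `archType (χW V c) + slotType (slotChi₂ · c₂) = μ 2`.** -/
theorem hμ₂_iff_archType (c₂ : ↥(relNormOneInfUnits (↥(NumberField.maximalRealSubfield (L : Type))) (L : Type)) →* ℂ)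
    (hχc : Continuous ⇑(slotChi₂ V c.D hGR hGR₂ hGR₃ * c₂)) (m : NumberField.InfinitePlace (L : Type) → ℤ) :
    (∀ t : ↥(relNormOneInfUnits (↥(NumberField.maximalRealSubfield (L : Type))) (L : Type)),
      ((eta₂ V c.D (EtaChi.η @χV @χW V c) (1, (UnitaryGroup.cmAdelicOneEquivRelNormOne (L : Type)).symm (relNormOneInfToIdeles (↥(NumberField.maximalRealSubfield (L : Type))) (L : Type) t)) *
              cmConjLineChar₀ (L : Type) finProdFinEquiv e₁ (frameD V) (frameD_real V) (frameD_ne V) (dW c.D) (dW_real c.D) (dW_ne c.D)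
                (dW' c.D) (dW'_real c.D) (dW'_ne c.D) c.D.isoGL (isoGL_hg₀ c.D) hGR hGR₂ hGR₃
                (1, CMCenter (L : Type) (lineVec (L : Type) (dW' c.D 0))
                  ((UnitaryGroup.cmAdelicOneEquivRelNormOne (L : Type)).symm (relNormOneInfToIdeles (↥(NumberField.maximalRealSubfield (L : Type))) (L : Type) t))) :
            ℂˣ) : ℂ) * c₂ t =
        archWeight (L : Type) m t) ↔
      UnitaryLineChar.archType (L : Type) (χW V c) + slotType (L := L) (slotChi₂ V c.D hGR hGR₂ hGR₃ * c₂) hχc = m := by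
  rw [hμ₂_iff_charArchType V c.D hGR hGR₂ hGR₃ (EtaChi.η @χV @χW V c) (continuous_etaInf_eta χV χW V c 2) c₂ hχc m,
    charArchType_etaInf_eta]
  rfl

/-- **`hμ₃` at the Stage-B η ↔ `archType (χW V c) + slotType (slotChi₃ · c₃) = μ 3`.** -/
theorem hμ₃_iff_archType (c₃ : ↥(relNormOneInfUnits (↥(NumberField.maximalRealSubfield (L : Type))) (L : Type)) →* ℂ)
    (hχc : Continuous ⇑(slotChi₃ V c.D hGR hGR₂ hGR₃ * c₃)) (m : NumberField.InfinitePlace (L : Type) → ℤ) :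
    (∀ t : ↥(relNormOneInfUnits (↥(NumberField.maximalRealSubfield (L : Type))) (L : Type)),
      ((eta₃ V c.D (EtaChi.η @χV @χW V c) (1, (UnitaryGroup.cmAdelicOneEquivRelNormOne (L : Type)).symm (relNormOneInfToIdeles (↥(NumberField.maximalRealSubfield (L : Type))) (L : Type) t)) *
              cmConjLineChar₁ (L : Type) finProdFinEquiv e₁ (frameD V) (frameD_real V) (frameD_ne V) (dW c.D) (dW_real c.D) (dW_ne c.D)
                (dW' c.D) (dW'_real c.D) (dW'_ne c.D) c.D.isoGL (isoGL_hg₀ c.D) hGR hGR₂ hGR₃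
                (1, CMCenter (L : Type) (lineVec (L : Type) (dW' c.D 1))
                  ((UnitaryGroup.cmAdelicOneEquivRelNormOne (L : Type)).symm (relNormOneInfToIdeles (↥(NumberField.maximalRealSubfield (L : Type))) (L : Type) t))) :
            ℂˣ) : ℂ) * c₃ t =
        archWeight (L : Type) m t) ↔
      UnitaryLineChar.archType (L : Type) (χW V c) + slotType (L := L) (slotChi₃ V c.D hGR hGR₂ hGR₃ * c₃) hχc = m := by
  rw [hμ₃_iff_charArchType V c.D hGR hGR₂ hGR₃ (EtaChi.η @χV @χW V c) (continuous_etaInf_eta χV χW V c 3) c₃ hχc m,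
    charArchType_etaInf_eta]
  rfl

/-! ### The slot-0 normalisation `nWOf` and the Δ-identities -/

/-- **given the slot-0 normalisation `archType (χW V c) = μ 0 − slotType₀`, every `hμₖ`-type identity IS a Δ-identity**:
`archType χW + sₖ = μ k ↔ sₖ − s₀ = μ k − μ 0` (pure integer arithmetic, stated once for all four slots). -/
theorem add_eq_iff_sub_eq_sub {a s₀ sₖ μ₀ μₖ : NumberField.InfinitePlace (L : Type) → ℤ} (ha : a = μ₀ - s₀) :
    a + sₖ = μₖ ↔ sₖ - s₀ = μₖ - μ₀ := by
  subst ha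
  constructor
  · intro h
    rw [← h]
    abel
  · intro h
    rw [sub_eq_iff_eq_add.1 h]
    abel

/-- **`hμ₀` HOLDS at any `χW` of type `μ 0 − slotType₀`** (e.g. `χW V c := EtaChi.χOfType @n V c` with `n V c = μ c 0 − slotType₀`,
by `EtaChi.hasArchType_χOfType`): the slot-0 (J-μ) obligation is a NORMALISATION, discharged by construction. -/
theorem hμ₀_of_archType_eq (c₀ : ↥(relNormOneInfUnits (↥(NumberField.maximalRealSubfield (L : Type))) (L : Type)) →* ℂ)
    (hχc : Continuous ⇑(slotChi₀ V c.D hGR hGR₀ hGR₁ * c₀)) (μ : Fin 4 → NumberField.InfinitePlace (L : Type) → ℤ)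
    (hW : UnitaryLineChar.archType (L : Type) (χW V c) = μ 0 - slotType (L := L) (slotChi₀ V c.D hGR hGR₀ hGR₁ * c₀) hχc) :
    ∀ t : ↥(relNormOneInfUnits (↥(NumberField.maximalRealSubfield (L : Type))) (L : Type)),
      ((eta₀ V c.D (EtaChi.η @χV @χW V c) (1, (UnitaryGroup.cmAdelicOneEquivRelNormOne (L : Type)).symm (relNormOneInfToIdeles (↥(NumberField.maximalRealSubfield (L : Type))) (L : Type) t)) *
              cmLineChar₀ (L : Type) finProdFinEquiv e₁ (frameD V) (frameD_real V) (frameD_ne V) (dW c.D) (dW_real c.D) (dW_ne c.D)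
                hGR hGR₀ hGR₁
                (1, CMCenter (L : Type) (lineVec (L : Type) (dW c.D 0))
                  ((UnitaryGroup.cmAdelicOneEquivRelNormOne (L : Type)).symm (relNormOneInfToIdeles (↥(NumberField.maximalRealSubfield (L : Type))) (L : Type) t))) :
            ℂˣ) : ℂ) * c₀ t =
        archWeight (L : Type) (μ 0) t :=
  (hμ₀_iff_archType χV χW V c hGR hGR₀ hGR₁ c₀ hχc (μ 0)).2 (by rw [hW, sub_add_cancel])

/-- **the archimedean type of a character of prescribed type** (`EtaChi.χOfType`, i.e. unitary-1's `unitaryLineCharOfType`) IS that type. -/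
theorem archType_χOfType (n : ∀ {L : CMField} {ι₁ : L →+* ℂ} (_V : HermSpace3 L ι₁) (_c : SeesawCtx L), NumberField.InfinitePlace (L : Type) → ℤ) :
    UnitaryLineChar.archType (L : Type) (EtaChi.χOfType @n V c) = n V c :=
  (EtaChi.hasArchType_χOfType @n V c).archType_eq

/-- **`nWOf`, THE SLOT-0 NORMALISATION OF THE W-CHARACTER TYPE**: `μ 0 − slotType (slotChi₀ · c₀)` when that character is continuous
(always, under plane-definiteness at `ι₁` — the CM-lines majorants), `0` otherwise (total, so that `EtaChi.χOfType @n` can take it as a family). -/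
def nWOf (c₀ : ↥(relNormOneInfUnits (↥(NumberField.maximalRealSubfield (L : Type))) (L : Type)) →* ℂ) (μ₀ : NumberField.InfinitePlace (L : Type) → ℤ) : NumberField.InfinitePlace (L : Type) → ℤ :=
  if h : Continuous ⇑(slotChi₀ V c.D hGR hGR₀ hGR₁ * c₀) then μ₀ - slotType (L := L) (slotChi₀ V c.D hGR hGR₀ hGR₁ * c₀) h else 0

omit χV χW in
/-- under continuity `nWOf = μ 0 − slotType₀`. -/
theorem nWOf_eq (c₀ : ↥(relNormOneInfUnits (↥(NumberField.maximalRealSubfield (L : Type))) (L : Type)) →* ℂ) (hχc : Continuous ⇑(slotChi₀ V c.D hGR hGR₀ hGR₁ * c₀)) (μ₀ : NumberField.InfinitePlace (L : Type) → ℤ) :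
    nWOf V c hGR hGR₀ hGR₁ c₀ μ₀ = μ₀ - slotType (L := L) (slotChi₀ V c.D hGR hGR₀ hGR₁ * c₀) hχc :=
  dif_pos hχc

/-- **`hμ₀` DISCHARGED BY CONSTRUCTION at `χW := EtaChi.χOfType @n` whenever `n V c = nWOf …`** (E's Stage-B choice of the W-character family). -/
theorem hμ₀_of_χOfType (n : ∀ {L : CMField} {ι₁ : L →+* ℂ} (_V : HermSpace3 L ι₁) (_c : SeesawCtx L), NumberField.InfinitePlace (L : Type) → ℤ)
    (c₀ : ↥(relNormOneInfUnits (↥(NumberField.maximalRealSubfield (L : Type))) (L : Type)) →* ℂ) (hχc : Continuous ⇑(slotChi₀ V c.D hGR hGR₀ hGR₁ * c₀)) (μ : Fin 4 → NumberField.InfinitePlace (L : Type) → ℤ)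
    (hn : n V c = nWOf V c hGR hGR₀ hGR₁ c₀ (μ 0)) :
    ∀ t : ↥(relNormOneInfUnits (↥(NumberField.maximalRealSubfield (L : Type))) (L : Type)),
      ((eta₀ V c.D (EtaChi.η @χV @(@EtaChi.χOfType @n) V c) (1, (UnitaryGroup.cmAdelicOneEquivRelNormOne (L : Type)).symm (relNormOneInfToIdeles (↥(NumberField.maximalRealSubfield (L : Type))) (L : Type) t)) *
              cmLineChar₀ (L : Type) finProdFinEquiv e₁ (frameD V) (frameD_real V) (frameD_ne V) (dW c.D) (dW_real c.D) (dW_ne c.D)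
                hGR hGR₀ hGR₁
                (1, CMCenter (L : Type) (lineVec (L : Type) (dW c.D 0))
                  ((UnitaryGroup.cmAdelicOneEquivRelNormOne (L : Type)).symm (relNormOneInfToIdeles (↥(NumberField.maximalRealSubfield (L : Type))) (L : Type) t))) :
            ℂˣ) : ℂ) * c₀ t =
        archWeight (L : Type) (μ 0) t :=
  hμ₀_of_archType_eq χV (@EtaChi.χOfType @n) V c hGR hGR₀ hGR₁ c₀ hχc μ
    (by rw [archType_χOfType, hn, nWOf_eq V c hGR hGR₀ hGR₁ c₀ hχc])

/-- **(J-μ)₁ AS A Δ-IDENTITY**: under the slot-0 normalisation, `hμ₁ ↔ slotType₁ − slotType₀ = μ 1 − μ 0`. -/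
theorem hμ₁_iff_sub (c₀ c₁ : ↥(relNormOneInfUnits (↥(NumberField.maximalRealSubfield (L : Type))) (L : Type)) →* ℂ) (hχ₀ : Continuous ⇑(slotChi₀ V c.D hGR hGR₀ hGR₁ * c₀))
    (hχ₁ : Continuous ⇑(slotChi₁ V c.D hGR hGR₀ hGR₁ * c₁)) (μ : Fin 4 → NumberField.InfinitePlace (L : Type) → ℤ)
    (hW : UnitaryLineChar.archType (L : Type) (χW V c) = μ 0 - slotType (L := L) (slotChi₀ V c.D hGR hGR₀ hGR₁ * c₀) hχ₀) :
    (∀ t : ↥(relNormOneInfUnits (↥(NumberField.maximalRealSubfield (L : Type))) (L : Type)),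
      ((eta₁ V c.D (EtaChi.η @χV @χW V c) (1, (UnitaryGroup.cmAdelicOneEquivRelNormOne (L : Type)).symm (relNormOneInfToIdeles (↥(NumberField.maximalRealSubfield (L : Type))) (L : Type) t)) *
              cmLineChar₁ (L : Type) finProdFinEquiv e₁ (frameD V) (frameD_real V) (frameD_ne V) (dW c.D) (dW_real c.D) (dW_ne c.D)
                hGR hGR₀ hGR₁
                (1, CMCenter (L : Type) (lineVec (L : Type) (dW c.D 1))
                  ((UnitaryGroup.cmAdelicOneEquivRelNormOne (L : Type)).symm (relNormOneInfToIdeles (↥(NumberField.maximalRealSubfield (L : Type))) (L : Type) t))) :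
            ℂˣ) : ℂ) * c₁ t =
        archWeight (L : Type) (μ 1) t) ↔
      slotType (L := L) (slotChi₁ V c.D hGR hGR₀ hGR₁ * c₁) hχ₁ - slotType (L := L) (slotChi₀ V c.D hGR hGR₀ hGR₁ * c₀) hχ₀ = μ 1 - μ 0 := by
  rw [hμ₁_iff_archType χV χW V c hGR hGR₀ hGR₁ c₁ hχ₁ (μ 1)]
  exact add_eq_iff_sub_eq_sub hW

variable (hGR₀' : (cmSplittingDatum (L : Type) (e₁) (frameD V) (frameD_real V) (frameD_ne V) (lineVec (L : Type) (dW c.D 0))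
    (fun _ => dW_real c.D 0) (fun _ => dW_ne c.D 0)).CompatibleSplitting) in
/-- **(J-μ)₂ AS A Δ-IDENTITY**: `hμ₂ ↔ slotType₂ − slotType₀ = μ 2 − μ 0`. -/
theorem hμ₂_iff_sub (c₀ c₂ : ↥(relNormOneInfUnits (↥(NumberField.maximalRealSubfield (L : Type))) (L : Type)) →* ℂ) (hχ₀ : Continuous ⇑(slotChi₀ V c.D hGR hGR₀ hGR₁ * c₀))
    (hχ₂ : Continuous ⇑(slotChi₂ V c.D hGR hGR₂ hGR₃ * c₂)) (μ : Fin 4 → NumberField.InfinitePlace (L : Type) → ℤ)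
    (hW : UnitaryLineChar.archType (L : Type) (χW V c) = μ 0 - slotType (L := L) (slotChi₀ V c.D hGR hGR₀ hGR₁ * c₀) hχ₀) :
    (∀ t : ↥(relNormOneInfUnits (↥(NumberField.maximalRealSubfield (L : Type))) (L : Type)),
      ((eta₂ V c.D (EtaChi.η @χV @χW V c) (1, (UnitaryGroup.cmAdelicOneEquivRelNormOne (L : Type)).symm (relNormOneInfToIdeles (↥(NumberField.maximalRealSubfield (L : Type))) (L : Type) t)) *
              cmConjLineChar₀ (L : Type) finProdFinEquiv e₁ (frameD V) (frameD_real V) (frameD_ne V) (dW c.D) (dW_real c.D) (dW_ne c.D)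
                (dW' c.D) (dW'_real c.D) (dW'_ne c.D) c.D.isoGL (isoGL_hg₀ c.D) hGR hGR₂ hGR₃
                (1, CMCenter (L : Type) (lineVec (L : Type) (dW' c.D 0))
                  ((UnitaryGroup.cmAdelicOneEquivRelNormOne (L : Type)).symm (relNormOneInfToIdeles (↥(NumberField.maximalRealSubfield (L : Type))) (L : Type) t))) :
            ℂˣ) : ℂ) * c₂ t =
        archWeight (L : Type) (μ 2) t) ↔
      slotType (L := L) (slotChi₂ V c.D hGR hGR₂ hGR₃ * c₂) hχ₂ - slotType (L := L) (slotChi₀ V c.D hGR hGR₀ hGR₁ * c₀) hχ₀ = μ 2 - μ 0 := by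
  rw [hμ₂_iff_archType χV χW V c hGR hGR₂ hGR₃ c₂ hχ₂ (μ 2)]
  exact add_eq_iff_sub_eq_sub hW

/-- **(J-μ)₃ AS A Δ-IDENTITY**: `hμ₃ ↔ slotType₃ − slotType₀ = μ 3 − μ 0`. -/
theorem hμ₃_iff_sub (c₀ c₃ : ↥(relNormOneInfUnits (↥(NumberField.maximalRealSubfield (L : Type))) (L : Type)) →* ℂ) (hχ₀ : Continuous ⇑(slotChi₀ V c.D hGR hGR₀ hGR₁ * c₀))
    (hχ₃ : Continuous ⇑(slotChi₃ V c.D hGR hGR₂ hGR₃ * c₃)) (μ : Fin 4 → NumberField.InfinitePlace (L : Type) → ℤ)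
    (hW : UnitaryLineChar.archType (L : Type) (χW V c) = μ 0 - slotType (L := L) (slotChi₀ V c.D hGR hGR₀ hGR₁ * c₀) hχ₀) :
    (∀ t : ↥(relNormOneInfUnits (↥(NumberField.maximalRealSubfield (L : Type))) (L : Type)),
      ((eta₃ V c.D (EtaChi.η @χV @χW V c) (1, (UnitaryGroup.cmAdelicOneEquivRelNormOne (L : Type)).symm (relNormOneInfToIdeles (↥(NumberField.maximalRealSubfield (L : Type))) (L : Type) t)) *
              cmConjLineChar₁ (L : Type) finProdFinEquiv e₁ (frameD V) (frameD_real V) (frameD_ne V) (dW c.D) (dW_real c.D) (dW_ne c.D)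
                (dW' c.D) (dW'_real c.D) (dW'_ne c.D) c.D.isoGL (isoGL_hg₀ c.D) hGR hGR₂ hGR₃
                (1, CMCenter (L : Type) (lineVec (L : Type) (dW' c.D 1))
                  ((UnitaryGroup.cmAdelicOneEquivRelNormOne (L : Type)).symm (relNormOneInfToIdeles (↥(NumberField.maximalRealSubfield (L : Type))) (L : Type) t))) :
            ℂˣ) : ℂ) * c₃ t =
        archWeight (L : Type) (μ 3) t) ↔
      slotType (L := L) (slotChi₃ V c.D hGR hGR₂ hGR₃ * c₃) hχ₃ - slotType (L := L) (slotChi₀ V c.D hGR hGR₀ hGR₁ * c₀) hχ₀ = μ 3 - μ 0 := by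
  rw [hμ₃_iff_archType χV χW V c hGR hGR₂ hGR₃ c₃ hχ₃ (μ 3)]
  exact add_eq_iff_sub_eq_sub hW

end StageB

end HodgeCM.Model.ArchSideTerm

end
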